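/-
Copyright (c) 2026 the pub-hodgecm-mathlib formalisation cell (harness21).  Prover seat hodgecm-mathlib-LH4-p11 (g5), req620 Track A «(D-RAM) FOUR-FRAME» squad
(unit U2H_HSide, the (ρ2b′-X) road :418; dealer LH4-plan (g12) WORD #28 «(β) half-split on `levelSetDep` cells → LH4-p11 (g5) NOW»; payer by lineage LH4-p14 (g4), socket (C)).
-/
import Summits.HodgeConjecture.HodgeConjecture.Theorems.F0P3cDyRamConeCellNormFibre       -- ★ p857531 (LH4-p12 (g4)): `exists_coneData_of_gen`, `map_glueNorm_eq` (via ★ p857402), DEFS leaf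
import Literature.NumberTheory.LocalFields.WildQuadraticDatumNormFibreValuesAbove           -- ★ p856861 T1: `#Sol_{2a}(r) = q^a` (a < d), `2q^a ∕ 0` (a ≥ d)
import Literature.NumberTheory.LocalFields.WildQuadraticDatumNormSignConductor              -- ★ `exists_nonnorm_dichotomy` (norm index two on the fixed line)
import HarnessLib

/-!
# Crux `H413`, line LH4 «(D-RAM) FOUR-FRAME» — the (ρ2b′-X) road, brick (β): THE CONE WEIGHT ON A DEPTH CELL SUMS TO `q^b · #levelSetDep(j, b; μ)`
# (the HALF SPLIT of the glue-norm classes on `levelSetDep` cells, proved as a SUM identity by a norm-flipping bijection — no class predicate, no representative choice)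

Cell `hodgecm-mathlib` (D-0151), FLOOR 0, crux item H413 = `stmt-HodgeConjecture-24833`, route of record `HCCMUnconditional`; squad F0∕P3c∕LH4; registered stub concerned:
`F0P3cDyRamFourFrameU2H.stub_U2H_fixedPointCensus_typeTwo_unit0` ((ρ2b′-X), U2H ED. 15 :418) through the payer lineage's census file (socket (C), LH4-p14 (g4)); this is the
seam (β) named by LH4-p10 (g3) line #7 between ★ (C1) `F0P3cDyRamBlockCensusOrderForm` (this seat, p857559) and the T5 tables (`q^b · #levelSetDep`).  THEOREMS ONLY (no `def`, no
instance, no notation, no `sorry`, default heartbeats); lane `--supports stmt-HodgeConjecture-24833 --as helper` (count-neutral).  No `tE`, no `t = 2`: `t` is the free exponent of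
the E-side datum.

WHAT IS PROVED.  Frame = ★ (C1) §2's (the plane `(E², H₂)` with `σ`, `|ϖ| = exp(−1)`, `H₂` hermitian of unit determinant, middle entry `h_W` a `σ`-fixed unit; the line model
`(M, jE, ρ, Θ, α; φ, lam, h)` with the value dictionary) + the E-SIDE WILD DATUM of ★ T1 (`IsRamifiedQuadraticDatum σ ϖ d t` on `E`, `|2| < 1`, `E` complete with finite residue
field of size `q`) + ONE «FLIP UNIT»: `z ∈ M`, `|z| = 1`, whose `Θ`-norm `z·Θz = jE ξ` is a `σ`-fixed NON-NORM `ξ` of `E` (type U: M∕K♮ unramified makes every unit of `F` a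
`Θ`-norm; the census file discharges it per descent type).  THEN for every weight `f` agreeing with `Nat.card Sol_{2b}(r)` on presented cone cells (the `hf` of ★ (C1),
VERBATIM), every conductor `j` with `lam ∈ 𝒪_j` and every tube `b ≥ 1`:
`Σᶠ_{Λ ∈ levelSetDep(j, b; lam − jE u)} f b j Λ = q^b · #levelSetDep(j, b; lam − jE u)`.
PROOF.  `Φ_z : Λ ↦ z·Λ` is a bijection of `levelSetDep(j, b; μ)` (inverse `Φ_{z⁻¹}`): a presented generator `x₀` goes to `z·x₀`, the dual generator to `ξ·(dual generator)` with
`ρξ = Θξ = ξ`, `|ξ| = 1`, so integrality, primitivity, level and the depth clause (★ DEFS `forall_herm_mul_mem_iff_isOrd_div`) are invariant (§1); the glue unit goes to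
`glueUnit ∕ ξ` (§1).  By ★ `exists_coneData_of_gen` + `map_glueNorm_eq` each cell carries a `σ`-fixed unit `r₀ ∈ E` with `jE r₀ = glueUnit(x₀, b)`, so `hf` evaluates
`f Λ + f (Φ_z Λ) = #Sol_{2b}(r₀) + #Sol_{2b}(r₀ ∕ ξ)`, which is `q^b + q^b` below the conductor (★ T1, class-blind) and `2q^b + 0` in some order at and above it (★ T1 + the index-two
dichotomy of ★ `exists_nonnorm_dichotomy`: exactly one of `r₀`, `r₀∕ξ` is a norm) (§2); summing over the bijection, `2·Σ f = 2q^b·#D` (§3).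
HONEST LABEL.  Count-neutral lattice∕norm bookkeeping; nothing printed is asserted; (ρ2b′-X) stays OPEN; `HC_CM` is proved only modulo the 7 printed citations (2 remaining named
inputs: hLiu418 = `stmt-HodgeConjecture-24832`, h413 = `stmt-HodgeConjecture-24833`) until rung 0 closes.

## References
* [Kottwitz1986BaseChangeUnits] R. E. Kottwitz, *Base change for unit elements of Hecke algebras*, Compositio Math. 60 (1986), §1 pp. 240–241 (fixed-lattice counts), §3
  pp. 247–249 (Levi blocks).
* [LabesseLanglands1979] J.-P. Labesse, R. P. Langlands, *L-indistinguishability for SL(2)*, Canad. J. Math. 31 (1979), §2 p. 8 (the norm-residue dichotomy in a quadratic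
  extension).
* [Serre1979] J.-P. Serre, *Local Fields*, GTM 67 (1979), Ch. V §3 Prop. 5, Cor. 2–3 pp. 84–86 (norm groups of a ramified quadratic extension).
* [Jacobowitz1962] R. Jacobowitz, *Hermitian forms over local fields*, Amer. J. Math. 84 (1962), §4 (dual lattices, gluing).
-/

set_option autoImplicit false

noncomputable section

open scoped Valued WithZero Matrix MatrixGroups
open WithZero
open scoped Classical
open Literature.NumberTheory.Automorphic Literature.NumberTheory.Automorphic.HermitianLattice Literature.NumberTheory.Automorphic.UnitaryLatticeTree
open Literature.NumberTheory.Automorphic.UnitaryThreeFourFrame (IsRamifiedQuadraticDatum)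
open Literature.NumberTheory.Automorphic.EllipticPlaneAsFieldLine
open Literature.NumberTheory.LocalFields.QuadraticOrder
open Literature.NumberTheory.LocalFields.WildQuadraticDatum
open Summit.HodgeConjecture.HodgeConjecture.Cruxes.H413.F0P3cDyRamToricCensusDefs
open Summit.HodgeConjecture.HodgeConjecture.Cruxes.H413.F0P3cDyRamConeLevelTransport

namespace Summit.HodgeConjecture.HodgeConjecture.Cruxes.H413.F0P3cDyRamConeWeightHalfSplit

/-! ## §1 The flip `x₀ ↦ z·x₀` on the line model (`z·Θz = ξ'`, `ρξ' = ξ'`, `|ξ'| = 1`): order clauses, dual generator, depth clause, glue unit -/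

section LineSide

variable {M : Type*} [Field M] [Valued M ℤᵐ⁰] {ρ Θ : M →+* M} {α : M}

/-- A `ρ`-fixed unit does not move the order predicate: `IsOrd c (ξ'·y) ↔ IsOrd c y`. [cite: Serre1979, Ch. III §6 Prop. 12] -/
theorem isOrd_mul_left_iff_of_fixed_unit {ξ' : M} (hρξ : ρ ξ' = ξ') (hξ1 : Valued.v ξ' = 1) (c y : M) :
    IsOrd ρ α c (ξ' * y) ↔ IsOrd ρ α c y := by
  have e : ξ' * y - ρ (ξ' * y) = ξ' * (y - ρ y) := by rw [map_mul, hρξ]; ring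
  rw [isOrd_iff, isOrd_iff, e, map_mul, map_mul, hξ1, one_mul, one_mul]

omit [Valued M ℤᵐ⁰] in
/-- The dual generator of `z·x₀` is `(z·Θz)` times that of `x₀`. [cite: Jacobowitz1962, §4] -/
theorem dualGen_mul_left {z ξ' : M} (hzξ : z * Θ z = ξ') (c h x₀ : M) :
    dualGen ρ Θ α c h (z * x₀) = ξ' * dualGen ρ Θ α c h x₀ := by
  rw [dualGen_def, dualGen_def, map_mul, show h * (z * x₀ * (Θ z * Θ x₀)) * (c * (α - ρ α)) = (z * Θ z) * (h * (x₀ * Θ x₀) * (c * (α - ρ α))) by ring, hzξ]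

omit [Valued M ℤᵐ⁰] in
/-- The glue unit of `z·x₀` is that of `x₀` divided by `ξ' = z·Θz` (`ρξ' = ξ'`, `Θ` an involution, the dual generator of `x₀` non-zero). [cite: Jacobowitz1962, §4] -/
theorem glueUnit_mul_left (hΘΘ : ∀ x, Θ (Θ x) = x) {z ξ' : M} (hzξ : z * Θ z = ξ') (hρξ : ρ ξ' = ξ') (hξ0 : ξ' ≠ 0)
    {c h x₀ : M} (hY0 : dualGen ρ Θ α c h x₀ ≠ 0) (ϖE cU : M) (b : ℕ) :
    glueUnit ρ Θ α c h ϖE cU (z * x₀) b = glueUnit ρ Θ α c h ϖE cU x₀ b / ξ' := by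
  have hΘξ : Θ ξ' = ξ' := by rw [← hzξ, map_mul, hΘΘ, mul_comm]
  have hΘY0 : Θ (dualGen ρ Θ α c h x₀) ≠ 0 := (map_ne_zero Θ).2 hY0
  have key : h * (z * x₀ * Θ (z * x₀)) / (dualGen ρ Θ α c h (z * x₀) * Θ (dualGen ρ Θ α c h (z * x₀))) =
      (h * (x₀ * Θ x₀) / (dualGen ρ Θ α c h x₀ * Θ (dualGen ρ Θ α c h x₀))) / ξ' := by
    rw [dualGen_mul_left hzξ, map_mul Θ ξ', hΘξ, map_mul Θ z x₀,
      show h * (z * x₀ * (Θ z * Θ x₀)) = (z * Θ z) * (h * (x₀ * Θ x₀)) by ring, hzξ]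
    field_simp
  rw [glueUnit_def, glueUnit_def, key, map_div₀, hρξ]
  ring

/-- **THE FLIP PRESERVES A PRESENTED CONE CELL.**  If `Λ = x₀·𝒪_c` is presented with the integrality, primitivity, level-`b` and depth clauses of `levelSetDep(·, b; μ)`, then
`z·Λ` (the image under `x ↦ z·x`) is presented by `z·x₀` with the same clauses, for any `z ≠ 0` with `z·Θz = ξ'`, `ρξ' = ξ'`, `|ξ'| = 1` (the depth clause through ★ DEFS
`forall_herm_mul_mem_iff_isOrd_div`). [cite: Jacobowitz1962, §4] [cite: Kottwitz1986BaseChangeUnits, §1 pp. 240–241] -/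
theorem cell_clauses_map_mulLeft (hρρ : ∀ x, ρ (ρ x) = x) (hvρ : ∀ x, Valued.v (ρ x) = Valued.v x) (hα : ρ α ≠ α) (hα1 : Valued.v α ≤ 1)
    (hint : ∀ z : M, Valued.v z ≤ 1 → Valued.v ((z - ρ z) / (α - ρ α)) ≤ 1)
    (hΘΘ : ∀ x, Θ (Θ x) = x) (hΘρ : ∀ x, Θ (ρ x) = ρ (Θ x)) (hvΘ : ∀ x, Valued.v (Θ x) = Valued.v x)
    {c : M} (hc : ρ c = c) (hc0 : c ≠ 0) (hc1 : Valued.v c ≤ 1) {h : M} (hh : h ≠ 0)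
    {z ξ' : M} (hz0 : z ≠ 0) (hzξ : z * Θ z = ξ') (hρξ : ρ ξ' = ξ') (hξ1 : Valued.v ξ' = 1)
    (ϖE μ : M) (b : ℕ) {Λ : AddSubgroup M} {x₀ : M} (hx₀ : x₀ ≠ 0)
    (hΛx : ∀ x, x ∈ Λ ↔ ∃ w, IsOrd ρ α c w ∧ x = x₀ * w)
    (hyO : IsOrd ρ α c (dualGen ρ Θ α c h x₀)) (hyprim : ¬ IsOrd ρ α c (dualGen ρ Θ α c h x₀ / ϖE))
    (hylev : Valued.v (dualGen ρ Θ α c h x₀) = Valued.v ϖE ^ b)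
    (hdep : ∀ b', (∀ x ∈ Λ, Valued.v (h * Θ x * b' + ρ (h * Θ x * b')) ≤ 1) → μ * b' ∈ Λ) :
    z * x₀ ≠ 0 ∧ (∀ x, x ∈ Λ.map (AddMonoidHom.mulLeft z) ↔ ∃ w, IsOrd ρ α c w ∧ x = z * x₀ * w) ∧
      IsOrd ρ α c (dualGen ρ Θ α c h (z * x₀)) ∧ ¬ IsOrd ρ α c (dualGen ρ Θ α c h (z * x₀) / ϖE) ∧
      Valued.v (dualGen ρ Θ α c h (z * x₀)) = Valued.v ϖE ^ b ∧
      (∀ b', (∀ x ∈ Λ.map (AddMonoidHom.mulLeft z), Valued.v (h * Θ x * b' + ρ (h * Θ x * b')) ≤ 1) → μ * b' ∈ Λ.map (AddMonoidHom.mulLeft z)) := by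
  have hzx₀ : z * x₀ ≠ 0 := mul_ne_zero hz0 hx₀
  have hξ0 : ξ' ≠ 0 := fun h0 => by rw [h0, map_zero] at hξ1; exact zero_ne_one hξ1
  have hρξi : ρ ξ'⁻¹ = ξ'⁻¹ := by rw [map_inv₀, hρξ]
  have hξi1 : Valued.v ξ'⁻¹ = 1 := by rw [map_inv₀, hξ1, inv_one]
  -- the image is presented by `z·x₀`
  have hΛ'x : ∀ x, x ∈ Λ.map (AddMonoidHom.mulLeft z) ↔ ∃ w, IsOrd ρ α c w ∧ x = z * x₀ * w := by
    intro x
    rw [AddSubgroup.mem_map]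
    constructor
    · rintro ⟨x', hx', rfl⟩
      obtain ⟨w, hw, rfl⟩ := (hΛx x').1 hx'
      exact ⟨w, hw, by rw [AddMonoidHom.coe_mulLeft]; ring⟩
    · rintro ⟨w, hw, rfl⟩
      exact ⟨x₀ * w, (hΛx _).2 ⟨w, hw, rfl⟩, by rw [AddMonoidHom.coe_mulLeft]; ring⟩
  have hY : dualGen ρ Θ α c h (z * x₀) = ξ' * dualGen ρ Θ α c h x₀ := dualGen_mul_left hzξ c h x₀
  refine ⟨hzx₀, hΛ'x, ?_, ?_, ?_, ?_⟩
  · rw [hY, isOrd_mul_left_iff_of_fixed_unit hρξ hξ1]; exact hyO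
  · rw [hY, mul_div_assoc, isOrd_mul_left_iff_of_fixed_unit hρξ hξ1]; exact hyprim
  · rw [hY, map_mul, hξ1, one_mul, hylev]
  · -- the depth clause: `IsOrd (μ ∕ Y) ⇒ IsOrd (μ ∕ (ξ'Y)) = IsOrd (ξ'⁻¹·(μ ∕ Y))`
    have hdepY := (forall_herm_mul_mem_iff_isOrd_div hρρ hvρ hα hα1 hint hΘΘ hΘρ hvΘ hc hc0 hc1 hh hx₀ hΛx μ).1 hdep
    refine (forall_herm_mul_mem_iff_isOrd_div hρρ hvρ hα hα1 hint hΘΘ hΘρ hvΘ hc hc0 hc1 hh hzx₀ hΛ'x μ).2 ?_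
    rw [hY, mul_comm ξ', ← div_div, div_eq_inv_mul (μ / dualGen ρ Θ α c h x₀), isOrd_mul_left_iff_of_fixed_unit hρξi hξi1]
    exact hdepY

end LineSide

/-! ## §2 The E-side: one of `r`, `r ∕ ξ` is a norm and the other is not (index two), so `#Sol_{2b}(r) + #Sol_{2b}(r ∕ ξ) = 2q^b` for every `b ≥ 1` -/

section NormSide

variable {E : Type} [Field E] [Valued E ℤᵐ⁰] {σ : E →+* E} {ϖ : E} {d t : ℕ}

/-- **INDEX TWO ON THE FIXED LINE, READ AS A FLIP**: for `σ`-fixed non-zero `r` and a `σ`-fixed NON-NORM `ξ`, `r` is a norm iff `r ∕ ξ` is not (★ `exists_nonnorm_dichotomy`).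
[cite: LabesseLanglands1979, §2 p. 8] [cite: Serre1979, Ch. V §3 Cor. 3] -/
theorem isNorm_iff_not_isNorm_div [CompleteSpace E] [Finite 𝓀[E]] (hD : IsRamifiedQuadraticDatum σ ϖ d t)
    {r ξ : E} (hσr : σ r = r) (hr0 : r ≠ 0) (hσξ : σ ξ = ξ) (hξN : ¬ ∃ e : E, e * σ e = ξ) :
    (∃ e : E, e * σ e = r) ↔ ¬ ∃ e : E, e * σ e = r / ξ := by
  have hσσ := hD.1
  have hξ0 : ξ ≠ 0 := fun h0 => hξN ⟨0, by rw [h0, zero_mul]⟩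
  obtain ⟨c₀, hσc₀, hc₀N, hdich⟩ := exists_nonnorm_dichotomy hD
  have hc₀0 : c₀ ≠ 0 := fun h0 => hc₀N ⟨0, by rw [h0, zero_mul]⟩
  constructor
  · rintro ⟨e₁, he₁⟩ ⟨e₂, he₂⟩
    have he₂0 : e₂ ≠ 0 := by
      rintro rfl; rw [zero_mul] at he₂; exact div_ne_zero hr0 hξ0 he₂.symm
    refine hξN ⟨e₁ / e₂, ?_⟩
    rw [map_div₀, div_mul_div_comm, he₁, he₂]
    field_simp
  · intro hN
    by_contra hrN
    -- `r ∉ N`, `ξ ∉ N` ⇒ `c₀r, c₀ξ ∈ N` ⇒ `r ∕ ξ = (c₀r) ∕ (c₀ξ) ∈ N`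
    obtain ⟨e₁, he₁⟩ : ∃ e : E, e * σ e = c₀ * r := (hdich r hσr hr0).resolve_left hrN
    obtain ⟨e₂, he₂⟩ : ∃ e : E, e * σ e = c₀ * ξ := (hdich ξ hσξ hξ0).resolve_left hξN
    have he₂0 : e₂ ≠ 0 := by
      rintro rfl; rw [zero_mul] at he₂; exact mul_ne_zero hc₀0 hξ0 he₂.symm
    refine hN ⟨e₁ / e₂, ?_⟩
    rw [map_div₀, div_mul_div_comm, he₁, he₂, mul_div_mul_left _ _ hc₀0]

/-- **THE FLIPPED PAIR OF GLUE COUNTS SUMS TO `2q^b`.**  At a wild ramified quadratic datum on a complete `E` with finite residue field, for a `σ`-fixed unit `r`, a `σ`-fixed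
NON-NORM unit `ξ` and `b ≥ 1`: `#Sol_{2b}(r) + #Sol_{2b}(r ∕ ξ) = 2·q^b` — below the conductor both are `q^b` (★ T1 `natCard_normFibre_eq_pow_of_succ_le`, class-blind), at and above
it exactly one of `r`, `r ∕ ξ` is a norm (§2) and ★ T1 gives `2q^b ∕ 0`. [cite: Serre1979, Ch. V §3 Prop. 5, Cor. 2–3 pp. 84–86] [cite: LabesseLanglands1979, §2 p. 8] -/
theorem natCard_normFibre_add_natCard_normFibre_div_eq [CompleteSpace E] [IsDiscreteValuationRing 𝒪[E]] [Finite 𝓀[E]]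
    (hD : IsRamifiedQuadraticDatum σ ϖ d t) (h2v : Valued.v (2 : E) < 1)
    {r ξ : E} (hσr : σ r = r) (hr1 : Valued.v r = 1) (hσξ : σ ξ = ξ) (hξ1 : Valued.v ξ = 1) (hξN : ¬ ∃ e : E, e * σ e = ξ) {b : ℕ} (hb : 1 ≤ b) :
    Nat.card {x : 𝒪[E] ⧸ 𝓂[E] ^ (2 * b) // ∃ u' : 𝒪[E], Ideal.Quotient.mk (𝓂[E] ^ (2 * b)) u' = x ∧ Valued.v ((u' : E) * σ u' - r) ≤ Valued.v (ϖ ^ (2 * b))} +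
      Nat.card {x : 𝒪[E] ⧸ 𝓂[E] ^ (2 * b) // ∃ u' : 𝒪[E], Ideal.Quotient.mk (𝓂[E] ^ (2 * b)) u' = x ∧ Valued.v ((u' : E) * σ u' - r / ξ) ≤ Valued.v (ϖ ^ (2 * b))} =
      2 * Nat.card 𝓀[E] ^ b := by
  have hr0 : r ≠ 0 := fun h0 => by rw [h0, map_zero] at hr1; exact zero_ne_one hr1
  have hσr' : σ (r / ξ) = r / ξ := by rw [map_div₀, hσr, hσξ]
  have hr'1 : Valued.v (r / ξ) = 1 := by rw [map_div₀, hr1, hξ1, div_one]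
  by_cases hbd : b + 1 ≤ d
  · rw [natCard_normFibre_eq_pow_of_succ_le hD h2v hσr hr1 hb hbd, natCard_normFibre_eq_pow_of_succ_le hD h2v hσr' hr'1 hb hbd, two_mul]
  · have hdb : d ≤ b := by omega
    by_cases hN : ∃ e : E, e * σ e = r
    · have hN' : ¬ ∃ e : E, e * σ e = r / ξ := (isNorm_iff_not_isNorm_div hD hσr hr0 hσξ hξN).1 hN
      rw [natCard_normFibre_eq_two_mul_pow_of_exists hD h2v hr1 hN hdb, natCard_normFibre_eq_zero_of_not_exists_of_le hD hσr' hr'1 hN' hdb, add_zero]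
    · have hN' : ∃ e : E, e * σ e = r / ξ := by
        by_contra h'; exact hN ((isNorm_iff_not_isNorm_div hD hσr hr0 hσξ hξN).2 h')
      rw [natCard_normFibre_eq_zero_of_not_exists_of_le hD hσr hr1 hN hdb, natCard_normFibre_eq_two_mul_pow_of_exists hD h2v hr'1 hN' hdb, zero_add]

end NormSide

/-! ## §3 HEAD — the cone weight on a depth cell sums to `q^b · #cell` -/

section Head

variable {E : Type} {M : Type*} [Field E] [Valued E ℤᵐ⁰] [Field M] [Valued M ℤᵐ⁰] {ρ Θ : M →+* M} {α : M}

/-- **(β) THE CONE WEIGHT ON A DEPTH CELL (HEAD).**  Frame of ★ (C1) §2 (`F0P3cDyRamBlockCensusOrderForm.finsum_ncard_glueFibre_eq_sum_levelSetDep`) + the E-side wild datum of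
★ T1 + a FLIP UNIT `z` (`|z| = 1`, `z·Θz = jE ξ`, `ξ` a `σ`-fixed NON-NORM of `E`).  Then for every weight `f` with the agreement hypothesis `hf` of ★ (C1) (verbatim), every `b ≥ 1`
and every conductor `j` with `lam ∈ 𝒪_j`:  `Σᶠ_{Λ ∈ levelSetDep(j, b; lam − jE u)} f b j Λ = (Nat.card 𝓀[E]) ^ b · #levelSetDep(j, b; lam − jE u)`.  (Below the conductor this is ★
T1's class-blind value; at and above it, the HALF SPLIT of the glue-norm classes on the depth cell, realised by the norm-flipping bijection `Λ ↦ z·Λ`.)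
[cite: Kottwitz1986BaseChangeUnits, §1 pp. 240–241] [cite: Serre1979, Ch. V §3 Prop. 5, Cor. 2–3 pp. 84–86] [cite: LabesseLanglands1979, §2 p. 8] [cite: Jacobowitz1962, §4] -/
theorem finsum_levelSetDep_weight_eq_pow_mul_ncard [CompleteSpace E] [IsDiscreteValuationRing 𝒪[E]] [Finite 𝓀[E]]
    (σ : E →+* E) (hσ : ∀ a, σ (σ a) = a) (hvσ : ∀ a, Valued.v (σ a) = Valued.v a)
    {ϖ : E} (hϖ : Valued.v ϖ = WithZero.exp (-1 : ℤ)) {d t : ℕ} (hD : IsRamifiedQuadraticDatum σ ϖ d t) (h2v : Valued.v (2 : E) < 1)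
    {H₂ : Matrix (Fin 2) (Fin 2) E} (hH₂σ : (H₂.map σ)ᵀ = H₂) {hW : E} (hhW : Valued.v hW = 1) (hhWσ : σ hW = hW) (jE : E →+* M)
    (hρρ : ∀ x, ρ (ρ x) = x) (hvρ : ∀ x, Valued.v (ρ x) = Valued.v x) (hα : ρ α ≠ α) (hα1 : Valued.v α ≤ 1)
    (hint : ∀ z : M, Valued.v z ≤ 1 → Valued.v ((z - ρ z) / (α - ρ α)) ≤ 1)
    (hΘΘ : ∀ x, Θ (Θ x) = x) (hΘρ : ∀ x, Θ (ρ x) = ρ (Θ x)) (hvΘ : ∀ x, Valued.v (Θ x) = Valued.v x) (hΘj : ∀ x, Θ (jE x) = jE (σ x))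
    (hjv : ∀ c, Valued.v (jE c) ≤ 1 ↔ Valued.v c ≤ 1) (hjfix : ∀ z, ρ z = z ↔ ∃ c, jE c = z)
    (hjpow : ∀ (t : E) (n : ℤ), Valued.v (jE t) = Valued.v (jE ϖ) ^ n ↔ Valued.v t = Valued.v ϖ ^ n)
    (hϖmax : ∀ t : M, ρ t = t → Valued.v t < 1 → Valued.v t ≤ Valued.v (jE ϖ))
    (φ : (Fin 2 → E) →+ M) (hφs : ∀ (c : E) (x : Fin 2 → E), φ (c • x) = jE c * φ x) (hφi : Function.Injective φ) (hφo : Function.Surjective φ)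
    {γ₂ : GL (Fin 2) E} {lam h : M} (hφγ : ∀ x, φ ((γ₂ : Matrix (Fin 2) (Fin 2) E).mulVec x) = lam * φ x) (hlam : Valued.v lam = 1)
    (hΘh : Θ h = h) (hh : h ≠ 0) (hform : ∀ x y, jE (pairing σ H₂ x y) = h * Θ (φ x) * φ y + ρ (h * Θ (φ x) * φ y))
    (z : M) (hz1 : Valued.v z = 1) (ξ : E) (hzξ : z * Θ z = jE ξ) (hσξ : σ ξ = ξ) (hξN : ¬ ∃ e : E, e * σ e = ξ)
    (u : E) {b : ℕ} (hb : 1 ≤ b) {j : ℕ} (hlamj : IsOrd ρ α (jE ϖ ^ j) lam) (hfin : (levelSet ρ Θ α (jE ϖ) h j b).Finite)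
    (f : ℕ → ℕ → AddSubgroup M → ℕ)
    (hf : ∀ (b j : ℕ) (Λ : AddSubgroup M) (x₀ : M) (r : E), 1 ≤ b → x₀ ≠ 0 →
      (∀ x, x ∈ Λ ↔ ∃ z, IsOrd ρ α (jE ϖ ^ j) z ∧ x = x₀ * z) →
      IsOrd ρ α (jE ϖ ^ j) (dualGen ρ Θ α (jE ϖ ^ j) h x₀) → ¬ IsOrd ρ α (jE ϖ ^ j) (dualGen ρ Θ α (jE ϖ ^ j) h x₀ / jE ϖ) →
      Valued.v (dualGen ρ Θ α (jE ϖ ^ j) h x₀) = Valued.v (jE ϖ) ^ b →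
      (∀ b', (∀ x ∈ Λ, Valued.v (h * Θ x * b' + ρ (h * Θ x * b')) ≤ 1) → (lam - jE u) * b' ∈ Λ) →
      IsOrd ρ α (jE ϖ ^ j) lam → jE r = glueUnit ρ Θ α (jE ϖ ^ j) h (jE ϖ) (jE hW) x₀ b →
      f b j Λ = Nat.card {x : 𝒪[E] ⧸ 𝓂[E] ^ (2 * b) // ∃ u' : 𝒪[E], Ideal.Quotient.mk (𝓂[E] ^ (2 * b)) u' = x ∧
        Valued.v ((u' : E) * σ u' - r) ≤ Valued.v (ϖ ^ (2 * b))}) :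
    ∑ᶠ Λ ∈ levelSetDep ρ Θ α (jE ϖ) h j b (lam - jE u), f b j Λ =
      Nat.card 𝓀[E] ^ b * (levelSetDep ρ Θ α (jE ϖ) h j b (lam - jE u)).ncard := by
  classical
  -- scalars
  have hvϖ0 : Valued.v ϖ ≠ 0 := by rw [hϖ]; exact WithZero.exp_ne_zero
  have hϖ0 : ϖ ≠ 0 := fun h0 => by rw [h0, map_zero] at hvϖ0; exact hvϖ0 rfl
  have hϖ1 : Valued.v ϖ < 1 := by rw [hϖ, ← WithZero.exp_zero, WithZero.exp_lt_exp]; norm_num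
  set ϖE : M := jE ϖ with hϖE
  set c : M := ϖE ^ j with hcdef
  have hρϖ : ρ ϖE = ϖE := (hjfix ϖE).2 ⟨ϖ, rfl⟩
  have hϖE0 : ϖE ≠ 0 := (map_ne_zero jE).2 hϖ0
  have hϖE1 : Valued.v ϖE < 1 := by
    refine lt_of_le_of_ne ((hjv ϖ).2 hϖ1.le) fun hle => ?_
    have := (hjpow ϖ 0).1 (by rw [zpow_zero]; exact hle)
    rw [zpow_zero] at this
    exact hϖ1.ne this
  have hc : ρ c = c := by rw [hcdef, map_pow, hρϖ]
  have hc0 : c ≠ 0 := pow_ne_zero j hϖE0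
  have hc1 : Valued.v c ≤ 1 := by rw [hcdef, map_pow]; exact pow_le_one₀ zero_le hϖE1.le
  have hd0 : α - ρ α ≠ 0 := sub_ne_zero.2 (Ne.symm hα)
  -- the flip unit and its inverse
  set ξ' : M := jE ξ with hξ'def
  have hρξ' : ρ ξ' = ξ' := (hjfix ξ').2 ⟨ξ, rfl⟩
  have hξ'1 : Valued.v ξ' = 1 := by rw [← hzξ, map_mul, hvΘ, hz1, one_mul]
  have hξ'0 : ξ' ≠ 0 := fun h0 => by rw [h0, map_zero] at hξ'1; exact zero_ne_one hξ'1
  have hξ1 : Valued.v ξ = 1 := by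
    have := (hjpow ξ 0).1 (by rw [zpow_zero]; exact hξ'1)
    rwa [zpow_zero] at this
  have hz0 : z ≠ 0 := fun h0 => by rw [h0, map_zero] at hz1; exact zero_ne_one hz1
  have hzi0 : z⁻¹ ≠ 0 := inv_ne_zero hz0
  have hziξ : z⁻¹ * Θ z⁻¹ = ξ'⁻¹ := by rw [map_inv₀, ← mul_inv, hzξ]
  have hρξi : ρ ξ'⁻¹ = ξ'⁻¹ := by rw [map_inv₀, hρξ']
  have hξi1 : Valued.v ξ'⁻¹ = 1 := by rw [map_inv₀, hξ'1, inv_one]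
  -- the hermitian symmetry of `H₂` in the shape ★ `pairing_comm_of_hermitian` wants
  have hH : ∀ a b', σ (H₂ a b') = H₂ b' a := by
    intro a b'
    have := congrFun (congrFun hH₂σ b') a
    simpa [Matrix.transpose_apply, Matrix.map_apply] using this
  -- the cell and its finiteness
  set D : Set (AddSubgroup M) := levelSetDep ρ Θ α ϖE h j b (lam - jE u) with hDdef
  have hDfin : D.Finite := hfin.subset (levelSetDep_subset ρ Θ α ϖE h j b (lam - jE u))
  -- the flip and its inverse on additive subgroups
  set Φ : AddSubgroup M → AddSubgroup M := fun Λ => Λ.map (AddMonoidHom.mulLeft z) with hΦ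
  set Ψ : AddSubgroup M → AddSubgroup M := fun Λ => Λ.map (AddMonoidHom.mulLeft z⁻¹) with hΨ
  have hcompΨΦ : (AddMonoidHom.mulLeft z⁻¹).comp (AddMonoidHom.mulLeft z) = AddMonoidHom.id M := by
    ext x; simp [inv_mul_cancel_left₀ hz0]
  have hcompΦΨ : (AddMonoidHom.mulLeft z).comp (AddMonoidHom.mulLeft z⁻¹) = AddMonoidHom.id M := by
    ext x; simp [mul_inv_cancel_left₀ hz0]
  have hΨΦ : ∀ Λ, Ψ (Φ Λ) = Λ := fun Λ => by
    simp only [hΦ, hΨ, AddSubgroup.map_map, hcompΨΦ, AddSubgroup.map_id]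
  have hΦΨ : ∀ Λ, Φ (Ψ Λ) = Λ := fun Λ => by
    simp only [hΦ, hΨ, AddSubgroup.map_map, hcompΦΨ, AddSubgroup.map_id]
  -- the flip (either direction) maps the cell to itself
  have hmaps : ∀ {z₁ ξ₁ : M}, z₁ ≠ 0 → z₁ * Θ z₁ = ξ₁ → ρ ξ₁ = ξ₁ → Valued.v ξ₁ = 1 →
      ∀ Λ ∈ D, Λ.map (AddMonoidHom.mulLeft z₁) ∈ D := by
    intro z₁ ξ₁ hz₁ hzξ₁ hρξ₁ hξ₁1 Λ hΛ
    obtain ⟨⟨x₀, hx₀, hΛx, hyO, hyprim, hylev⟩, hdepΛ⟩ := hΛ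
    obtain ⟨hzx₀, hΛ'x, hyO', hyprim', hylev', hdep'⟩ :=
      cell_clauses_map_mulLeft hρρ hvρ hα hα1 hint hΘΘ hΘρ hvΘ hc hc0 hc1 hh hz₁ hzξ₁ hρξ₁ hξ₁1 ϖE (lam - jE u) b hx₀ hΛx hyO hyprim hylev hdepΛ
    exact ⟨⟨z₁ * x₀, hzx₀, hΛ'x, hyO', hyprim', hylev'⟩, hdep'⟩
  have hmapsΦ : ∀ Λ ∈ D, Φ Λ ∈ D := hmaps hz0 hzξ hρξ' hξ'1
  have hmapsΨ : ∀ Λ ∈ D, Ψ Λ ∈ D := hmaps hzi0 hziξ hρξi hξi1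
  -- the value of a flipped pair
  have hpair : ∀ Λ ∈ D, f b j Λ + f b j (Φ Λ) = 2 * Nat.card 𝓀[E] ^ b := by
    intro Λ hΛ
    obtain ⟨⟨x₀, hx₀, hΛx, hyO, hyprim, hylev⟩, hdepΛ⟩ := hΛ
    -- the canonical cone data of the cell: a `σ`-fixed unit `r₀ ∈ E` with `jE r₀ = glueUnit(x₀, b)`
    obtain ⟨B', -, -, -, w₀, hw₀Y, -, -, hw₀, -⟩ := exists_coneData_of_gen σ hϖ0 hϖ1 H₂ jE hρρ hvρ hα hα1 hint hΘΘ hΘρ hvΘ hjv hjfix hjpow hϖmax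
      φ hφs hφi hφo hφγ hlam hΘh hh hform u hb hx₀ hΛx hyO hyprim hylev hdepΛ hlamj
    set r₀ : E := -(pairing σ H₂ w₀ w₀) * (ϖ ^ b * σ (ϖ ^ b)) / hW with hr₀def
    have hr₀ : jE r₀ = glueUnit ρ Θ α c h ϖE (jE hW) x₀ b := map_glueNorm_eq σ H₂ jE hΘj φ hform hw₀Y ϖ hW b
    have hpair₀ : σ (pairing σ H₂ w₀ w₀) = pairing σ H₂ w₀ w₀ := (pairing_comm_of_hermitian hσ hH w₀ w₀).symm
    have hσr₀ : σ r₀ = r₀ := by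
      rw [hr₀def, map_div₀, map_mul, map_neg, hpair₀, map_mul, hσ, hhWσ, mul_comm (σ (ϖ ^ b)) (ϖ ^ b)]
    have hr₀1 : Valued.v r₀ = 1 := by
      rw [hr₀def, map_div₀, map_mul, Valuation.map_neg, map_mul, hvσ, map_pow, hhW, div_one, ← pow_add, ← two_mul]
      exact hw₀
    -- the flipped cell is presented by `z·x₀` and carries `r₀ ∕ ξ`
    obtain ⟨hzx₀, hΛ'x, hyO', hyprim', hylev', hdep'⟩ :=
      cell_clauses_map_mulLeft hρρ hvρ hα hα1 hint hΘΘ hΘρ hvΘ hc hc0 hc1 hh hz0 hzξ hρξ' hξ'1 ϖE (lam - jE u) b hx₀ hΛx hyO hyprim hylev hdepΛ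
    have hY0 : dualGen ρ Θ α c h x₀ ≠ 0 := by
      rw [dualGen_def]
      exact mul_ne_zero (mul_ne_zero hh (mul_ne_zero hx₀ ((map_ne_zero Θ).2 hx₀))) (mul_ne_zero hc0 hd0)
    have hr₀' : jE (r₀ / ξ) = glueUnit ρ Θ α c h ϖE (jE hW) (z * x₀) b := by
      rw [map_div₀, hr₀, glueUnit_mul_left hΘΘ hzξ hρξ' hξ'0 hY0]
    rw [hf b j Λ x₀ r₀ hb hx₀ hΛx hyO hyprim hylev hdepΛ hlamj hr₀,
      hf b j (Φ Λ) (z * x₀) (r₀ / ξ) hb hzx₀ hΛ'x hyO' hyprim' hylev' hdep' hlamj hr₀']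
    exact natCard_normFibre_add_natCard_normFibre_div_eq hD h2v hσr₀ hr₀1 hσξ hξ1 hξN hb
  -- summation over the bijection
  rw [finsum_mem_eq_finite_toFinset_sum _ hDfin, Set.ncard_eq_toFinset_card _ hDfin]
  set T := hDfin.toFinset with hTdef
  have hT : ∀ Λ, Λ ∈ T ↔ Λ ∈ D := fun Λ => Set.Finite.mem_toFinset hDfin
  have hreidx : ∑ Λ ∈ T, f b j (Φ Λ) = ∑ Λ ∈ T, f b j Λ :=
    Finset.sum_nbij' Φ Ψ (fun Λ hΛ => (hT _).2 (hmapsΦ Λ ((hT Λ).1 hΛ))) (fun Λ hΛ => (hT _).2 (hmapsΨ Λ ((hT Λ).1 hΛ)))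
      (fun Λ _ => hΨΦ Λ) (fun Λ _ => hΦΨ Λ) (fun _ _ => rfl)
  have h2 : 2 * ∑ Λ ∈ T, f b j Λ = 2 * (Nat.card 𝓀[E] ^ b * T.card) := by
    calc 2 * ∑ Λ ∈ T, f b j Λ = ∑ Λ ∈ T, f b j Λ + ∑ Λ ∈ T, f b j (Φ Λ) := by rw [two_mul, hreidx]
      _ = ∑ Λ ∈ T, (f b j Λ + f b j (Φ Λ)) := Finset.sum_add_distrib.symm
      _ = ∑ Λ ∈ T, 2 * Nat.card 𝓀[E] ^ b := Finset.sum_congr rfl fun Λ hΛ => hpair Λ ((hT Λ).1 hΛ)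
      _ = 2 * (Nat.card 𝓀[E] ^ b * T.card) := by rw [Finset.sum_const, smul_eq_mul]; ring
  exact Nat.eq_of_mul_eq_mul_left (by norm_num) h2

end Head

/-! ## §4 (ED. 2) The flip unit DISCHARGED from «units fixed by `ρ` and `Θ` are `Θ`-norms» ((R-26) letter `(z, ξ)` of §3; LHref-N #376 (i)) -/

section FlipUnit

variable {E : Type} {M : Type*} [Field E] [Valued E ℤᵐ⁰] [Field M] [Valued M ℤᵐ⁰] {ρ Θ : M →+* M}

/-- **THE FLIP UNIT EXISTS WHENEVER THE BASE UNITS ARE `Θ`-NORMS.**  At a wild∕tame ramified quadratic datum on a complete `E` with finite residue field, if every unit of `M` fixed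
by `ρ` AND `Θ` is a hermitian norm `z·Θz` (`hFN` — type U: ★ `UnramifiedQuadraticNorm.exists_mul_map_eq_of_finite_residueField` on `𝒪[M]`, Serre V §2 Prop. 3; type RamK: ★
`exists_mul_map_eq_of_fixed_fixed_of_thirdField`, «`𝒪_Fˣ ⊆ N_{M∕K♮}(𝒪_Mˣ)»`), then there are `z ∈ M`, `ξ ∈ E` with `|z| = 1`, `z·Θz = jE ξ`, `σξ = ξ` and `ξ ∉ N(Eˣ)` — the
four binders `(hz1, hzξ, hσξ, hξN)` of §3 `finsum_levelSetDep_weight_eq_pow_mul_ncard`.  (`ξ` = ★ `exists_unit_nonnorm_dichotomy_of_isRamifiedQuadraticDatum`'s non-norm UNIT.)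
[cite: Serre1979, Ch. V §2 Prop. 3; Ch. V §3 Cor. 3] [cite: LabesseLanglands1979, §2 p. 8] -/
theorem exists_flipUnit_of_forall_fixed_fixed_isNorm [CompleteSpace E] [Finite 𝓀[E]]
    (σ : E →+* E) {ϖ : E} {d t : ℕ} (hD : IsRamifiedQuadraticDatum σ ϖ d t) (jE : E →+* M)
    (hvΘ : ∀ x, Valued.v (Θ x) = Valued.v x) (hΘj : ∀ x, Θ (jE x) = jE (σ x)) (hjfix : ∀ z, ρ z = z ↔ ∃ c, jE c = z)
    (hjpow : ∀ (t : E) (n : ℤ), Valued.v (jE t) = Valued.v (jE ϖ) ^ n ↔ Valued.v t = Valued.v ϖ ^ n)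
    (hFN : ∀ f : M, ρ f = f → Θ f = f → Valued.v f = 1 → ∃ z : M, z * Θ z = f) :
    ∃ (z : M) (ξ : E), Valued.v z = 1 ∧ z * Θ z = jE ξ ∧ σ ξ = ξ ∧ ¬ ∃ e : E, e * σ e = ξ := by
  haveI : IsAdicComplete 𝓂[E] 𝒪[E] := Literature.NumberTheory.LocalFields.isAdicComplete_valuedInteger_of_completeSpace hD.2.2.1
  obtain ⟨ξ, hσξ, hξ1, hξN, -⟩ := exists_unit_nonnorm_dichotomy_of_isRamifiedQuadraticDatum σ ϖ d t hD
  have hρf : ρ (jE ξ) = jE ξ := (hjfix _).2 ⟨ξ, rfl⟩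
  have hΘf : Θ (jE ξ) = jE ξ := by rw [hΘj, hσξ]
  have hf1 : Valued.v (jE ξ) = 1 := by
    have := (hjpow ξ 0).2 (by rw [zpow_zero]; exact hξ1)
    rwa [zpow_zero] at this
  obtain ⟨z, hz⟩ := hFN (jE ξ) hρf hΘf hf1
  refine ⟨z, ξ, ?_, hz, hσξ, hξN⟩
  have h2 : Valued.v z ^ 2 = 1 := by rw [sq, ← hf1, ← hz, map_mul, hvΘ]
  exact (pow_eq_one_iff_of_nonneg zero_le two_ne_zero).1 h2

end FlipUnit

end Summit.HodgeConjecture.HodgeConjecture.Cruxes.H413.F0P3cDyRamConeWeightHalfSplit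

end
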